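import Literature.Probability.RandomPlanarGeometry.ShearComparisonLimits
import Literature.Probability.RandomPlanarGeometry.ConformalMapProofs
import Mathlib.Analysis.Complex.CauchyIntegral
import Mathlib.Analysis.Calculus.FDeriv.RestrictScalars
import HarnessLib

/-!
# The comparison map of a sheared quadrilateral: bijection, inverse, derivative, line limits

Topic `Literature/Probability/RandomPlanarGeometry`; continuation of `ShearComparisonLimits.lean`
(variational proof of `ShearCrossRatioAnalytic`). Everything is PROVED. For the comparison map
`Θ₀ = F_k ∘ F⁻¹ ∘ φ_α ∘ f : ℍₒ → (-K, K) × (0, K')` of a sheared quad (notation of that file):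

* `mapsTo_comparison`, `injOn_comparison`, `image_comparison` — `Θ₀` is a bijection of `ℍₒ`
  onto the open rectangle `scrRect k`;
* `mapsTo_inverse`, `inverse_comparison`, `comparison_inverse`, `contDiffOn_inverse` — its
  inverse `Ψ₀ = f⁻¹ ∘ φ_α⁻¹ ∘ F ∘ F_k⁻¹` and its smoothness;
* `hasFDerivAt_comparison` (& `_apply_one`, `_apply_I`, `deriv_symm_comp_ne_zero`) — the real
  derivative of `Θ₀` has the SHEAR FORM `A 1 = γ φ_α(h)`, `A i = γ φ_α(ih)` with `h = f′ ≠ 0`,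
  `γ = (F_k ∘ F⁻¹)′ ≠ 0`, as required by `DirichletPullback.setIntegral_image_gradSq_eq`;
* `tendsto_of_compact` and `exists_compact_eventually_mem` — the compactness lemma behind the
  boundary limits of transported competitors along horizontal lines: if `Θ → p` along a filter
  living in a compact set on which `Θ = p` forces `u = c`, then `u → c`; and a filter on `ℍₒ`
  along which `Θ₀` tends to a point other than its limit at `∞` lives in a compact set.

## References

* L. V. Ahlfors, *Lectures on Quasiconformal Mappings* (1966), Ch. I.
* Ch. Pommerenke, *Boundary Behaviour of Conformal Maps* (1992), Thm. 2.6. [folklore]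
-/

noncomputable section

open Set Filter Topology Complex Metric
open UpperHalfPlane (upperHalfPlaneSet isOpen_upperHalfPlaneSet)

namespace Literature.Probability.RandomPlanarGeometry

open Literature.Barriers.CriticalPhenomena (moduliShear shearHomeomorph coe_shearHomeomorph
  continuous_moduliShear)

namespace ShearComparison

/-! ### Two topological lemmas -/

/-- **Compactness lemma for boundary limits.** Let `Θ`, `u` be continuous on a compact set `K`
and suppose `u = c` at every point of `K` where `Θ = p`. If a filter `l` lives in `K` and
`Θ → p` along `l`, then `u → c` along `l`. [folklore] -/
theorem tendsto_of_compact {K : Set ℂ} (hK : IsCompact K) {Θ : ℂ → ℂ} {u : ℂ → ℝ}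
    (hΘ : ContinuousOn Θ K) (hu : ContinuousOn u K) {p : ℂ} {c : ℝ}
    (hp : ∀ z ∈ K, Θ z = p → u z = c) {l : Filter ℂ} (hlK : ∀ᶠ z in l, z ∈ K)
    (hl : Tendsto Θ l (𝓝 p)) : Tendsto u l (𝓝 c) := by
  rw [Metric.tendsto_nhds]
  intro ε hε
  set K₂ : Set ℂ := K ∩ u ⁻¹' {v : ℝ | ε ≤ dist v c} with hK₂
  have hK₂c : IsClosed K₂ :=
    hu.preimage_isClosed_of_isClosed hK.isClosed
      (isClosed_le continuous_const (continuous_id.dist continuous_const))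
  have hK₂ : IsCompact K₂ := hK.of_isClosed_subset hK₂c inter_subset_left
  have himg : IsCompact (Θ '' K₂) := hK₂.image_of_continuousOn (hΘ.mono inter_subset_left)
  have hpn : p ∉ Θ '' K₂ := by
    rintro ⟨z, ⟨hzK, hzε⟩, hzp⟩
    have h0 : u z = c := hp z hzK hzp
    have : ε ≤ dist (u z) c := hzε
    rw [h0, dist_self] at this
    linarith
  have hmem : (Θ '' K₂)ᶜ ∈ 𝓝 p := himg.isClosed.isOpen_compl.mem_nhds hpn
  filter_upwards [hlK, hl hmem] with z hzK hzV
  by_contra hge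
  exact hzV ⟨z, ⟨hzK, not_lt.1 hge⟩, rfl⟩

/-- **A filter along which `Θ` does not tend to its value at infinity lives in a compact set.**
If `Θ → L` at `∞` within `A`, `l` lives in `A` and `Θ → p ≠ L` along `l`, then `l` lives in a
compact set. [folklore] -/
theorem exists_compact_eventually_mem {Θ : ℂ → ℂ} {L p : ℂ} (hLp : L ≠ p) {A : Set ℂ}
    (hinf : Tendsto Θ (cocompact ℂ ⊓ 𝓟 A) (𝓝 L)) {l : Filter ℂ} (hlA : ∀ᶠ z in l, z ∈ A)
    (hl : Tendsto Θ l (𝓝 p)) : ∃ K : Set ℂ, IsCompact K ∧ ∀ᶠ z in l, z ∈ K := by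
  obtain ⟨V, W, hV, hW, hLV, hpW, hVW⟩ := t2_separation hLp
  have h1 : Θ ⁻¹' V ∈ cocompact ℂ ⊓ 𝓟 A := hinf (hV.mem_nhds hLV)
  rw [mem_inf_principal, Filter.mem_cocompact] at h1
  obtain ⟨K, hK, hKsub⟩ := h1
  refine ⟨K, hK, ?_⟩
  filter_upwards [hlA, hl (hW.mem_nhds hpW)] with z hzA hzW
  by_contra hzK
  have hzV : Θ z ∈ V := hKsub hzK hzA
  exact (Set.disjoint_iff.1 hVW) ⟨hzV, hzW⟩

/-- The shear is a continuous real-linear map: it is smooth. [folklore] -/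
theorem contDiff_moduliShear (β : ℂ) {n : WithTop ℕ∞} : ContDiff ℝ n (moduliShear β) := by
  have e : moduliShear β = ⇑(Complex.reCLM.smulRight (1 : ℂ) + Complex.imCLM.smulRight β) := by
    funext z
    simp only [add_apply, ContinuousLinearMap.smulRight_apply,
      Complex.reCLM_apply, Complex.imCLM_apply, Complex.real_smul, mul_one, moduliShear]
    ring
  rw [e]
  exact ContinuousLinearMap.contDiff _

/-! ### The comparison map is a bijection of `ℍₒ` onto the rectangle -/

section Bijection

variable {R' : ConformalRectangle} {α : ℂ} (hα : 0 < α.im)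
  (f : ConformalEquiv upperHalfPlaneSet R'.carrier)
  (F : ConformalEquiv upperHalfPlaneSet (R'.map (shearHomeomorph α hα.ne')).carrier)
  {k : ℝ} (hk0 : 0 < k) (hk1 : k < 1)

/-- `φ_α⁻¹` maps `φ_α(Ω')` back into `Ω'`. [folklore] -/
theorem symm_mem_carrier {w : ℂ} (hw : w ∈ (R'.map (shearHomeomorph α hα.ne')).carrier) :
    (shearHomeomorph α hα.ne').symm w ∈ R'.carrier := by
  rw [MarkedDomain.carrier_map] at hw
  obtain ⟨v, hv, rfl⟩ := hw
  rwa [Homeomorph.symm_apply_apply]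

include hk0 hk1

/-- `Θ₀` maps `ℍₒ` into the open rectangle `(-K, K) × (0, K')`. [folklore] -/
theorem mapsTo_comparison :
    MapsTo (fun w => scrFun k (F.symm (moduliShear α (f w)))) upperHalfPlaneSet (scrRect k) :=
  fun _ hw => (scrFun_bijOn hk0 hk1).mapsTo
    (F.symm_mapsTo (moduliShear_mem_carrier_map hα (f.mapsTo hw)))

/-- `Θ₀` is injective on `ℍₒ`. [folklore] -/
theorem injOn_comparison :
    InjOn (fun w => scrFun k (F.symm (moduliShear α (f w)))) upperHalfPlaneSet := by
  intro w hw w' hw' heq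
  have h1 := (scrFun_injOn hk0.le hk1.le) (F.symm_mapsTo (moduliShear_mem_carrier_map hα (f.mapsTo hw)))
    (F.symm_mapsTo (moduliShear_mem_carrier_map hα (f.mapsTo hw'))) heq
  have h2 := F.symm.injOn (moduliShear_mem_carrier_map hα (f.mapsTo hw))
    (moduliShear_mem_carrier_map hα (f.mapsTo hw')) h1
  have h3 := (shearHomeomorph α hα.ne').injective (by simpa using h2)
  exact f.injOn hw hw' h3

/-- `Ψ₀ = f⁻¹ ∘ φ_α⁻¹ ∘ F ∘ F_k⁻¹` maps the rectangle into `ℍₒ`. [folklore] -/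
theorem mapsTo_inverse :
    MapsTo (fun w => f.symm ((shearHomeomorph α hα.ne').symm
      (F (Function.invFunOn (scrFun k) upperHalfPlaneSet w)))) (scrRect k) upperHalfPlaneSet := by
  intro w hw
  have h1 : Function.invFunOn (scrFun k) upperHalfPlaneSet w ∈ upperHalfPlaneSet :=
    (scrFun_bijOn hk0 hk1).surjOn.mapsTo_invFunOn hw
  exact f.symm_mapsTo (symm_mem_carrier hα (F.mapsTo h1))

/-- `Θ₀ ∘ Ψ₀ = id` on the rectangle. [folklore] -/
theorem comparison_inverse {w : ℂ} (hw : w ∈ scrRect k) :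
    scrFun k (F.symm (moduliShear α (f (f.symm ((shearHomeomorph α hα.ne').symm
      (F (Function.invFunOn (scrFun k) upperHalfPlaneSet w))))))) = w := by
  have h1 : Function.invFunOn (scrFun k) upperHalfPlaneSet w ∈ upperHalfPlaneSet :=
    (scrFun_bijOn hk0 hk1).surjOn.mapsTo_invFunOn hw
  have h2 : F (Function.invFunOn (scrFun k) upperHalfPlaneSet w) ∈
      (R'.map (shearHomeomorph α hα.ne')).carrier := F.mapsTo h1
  rw [f.apply_symm_apply (symm_mem_carrier hα h2), ← coe_shearHomeomorph α hα.ne',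
    Homeomorph.apply_symm_apply, F.symm_apply_apply h1]
  exact (scrFun_bijOn hk0 hk1).invOn_invFunOn.2 hw

/-- `Ψ₀ ∘ Θ₀ = id` on `ℍₒ`. [folklore] -/
theorem inverse_comparison {z : ℂ} (hz : z ∈ upperHalfPlaneSet) :
    f.symm ((shearHomeomorph α hα.ne').symm (F (Function.invFunOn (scrFun k) upperHalfPlaneSet
      (scrFun k (F.symm (moduliShear α (f z))))))) = z := by
  have h1 : moduliShear α (f z) ∈ (R'.map (shearHomeomorph α hα.ne')).carrier :=
    moduliShear_mem_carrier_map hα (f.mapsTo hz)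
  have h2 : F.symm (moduliShear α (f z)) ∈ upperHalfPlaneSet := F.symm_mapsTo h1
  rw [(scrFun_bijOn hk0 hk1).invOn_invFunOn.1 h2, F.apply_symm_apply h1,
    ← coe_shearHomeomorph α hα.ne', Homeomorph.symm_apply_apply, f.symm_apply_apply hz]

/-- `Θ₀(ℍₒ)` is the whole open rectangle. [folklore] -/
theorem image_comparison :
    (fun w => scrFun k (F.symm (moduliShear α (f w)))) '' upperHalfPlaneSet = scrRect k := by
  refine (mapsTo_comparison hα f F hk0 hk1).image_subset.antisymm fun w hw => ?_
  exact ⟨_, mapsTo_inverse hα f F hk0 hk1 hw, comparison_inverse hα f F hk0 hk1 hw⟩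

/-- `Θ₀` is continuously differentiable on `ℍₒ` (indeed real-analytic). [folklore] -/
theorem contDiffOn_comparison :
    ContDiffOn ℝ 1 (fun w => scrFun k (F.symm (moduliShear α (f w)))) upperHalfPlaneSet := by
  have h1 : ContDiffOn ℝ 1 f upperHalfPlaneSet :=
    ((f.differentiableOn.contDiffOn isOpen_upperHalfPlaneSet).restrict_scalars ℝ).of_le le_top
  have h2 : ContDiffOn ℝ 1 (moduliShear α) univ := (contDiff_moduliShear α).contDiffOn
  have h3 : ContDiffOn ℝ 1 F.symm (R'.map (shearHomeomorph α hα.ne')).carrier :=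
    ((F.symm.differentiableOn.contDiffOn (R'.map _).isOpen).restrict_scalars ℝ).of_le le_top
  have h4 : ContDiffOn ℝ 1 (scrFun k) upperHalfPlaneSet :=
    (((differentiableOn_scrFun_upperHalfPlaneSet hk0.le hk1.le).contDiffOn
      isOpen_upperHalfPlaneSet).restrict_scalars ℝ).of_le le_top
  have h21 : ContDiffOn ℝ 1 (fun w => moduliShear α (f w)) upperHalfPlaneSet :=
    h2.comp h1 (mapsTo_univ _ _)
  have h321 : ContDiffOn ℝ 1 (fun w => F.symm (moduliShear α (f w))) upperHalfPlaneSet :=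
    h3.comp h21 fun w hw => moduliShear_mem_carrier_map hα (f.mapsTo hw)
  exact h4.comp h321 fun w hw => F.symm_mapsTo (moduliShear_mem_carrier_map hα (f.mapsTo hw))

omit hk0 hk1 in
/-- `Ψ₀` is continuously differentiable on the rectangle (indeed real-analytic). [folklore] -/
theorem contDiffOn_inverse (hk0 : 0 < k) (hk1 : k < 1) :
    ContDiffOn ℝ 1 (fun w => f.symm ((shearHomeomorph α hα.ne').symm
      (F (Function.invFunOn (scrFun k) upperHalfPlaneSet w)))) (scrRect k) := by
  have hrect : IsOpen (scrRect k) := isOpen_Ioo.reProdIm isOpen_Ioo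
  -- `F_k⁻¹` is holomorphic on the rectangle
  have hinv : DifferentiableOn ℂ (Function.invFunOn (scrFun k) upperHalfPlaneSet) (scrRect k) := by
    rw [← scrFun_image_eq hk0 hk1]
    exact Complex.differentiableOn_invFunOn_image isOpen_upperHalfPlaneSet
      (differentiableOn_scrFun_upperHalfPlaneSet hk0.le hk1.le) (scrFun_bijOn hk0 hk1).injOn
      fun z hz => deriv_scrFun_ne_zero hk0.le hk1.le hz
  have h1 : ContDiffOn ℝ 1 (Function.invFunOn (scrFun k) upperHalfPlaneSet) (scrRect k) :=
    ((hinv.contDiffOn hrect).restrict_scalars ℝ).of_le le_top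
  have h2 : ContDiffOn ℝ 1 F upperHalfPlaneSet :=
    ((F.differentiableOn.contDiffOn isOpen_upperHalfPlaneSet).restrict_scalars ℝ).of_le le_top
  have h3 : ContDiffOn ℝ 1 (shearHomeomorph α hα.ne').symm univ :=
    (contDiff_moduliShear _).contDiffOn
  have h4 : ContDiffOn ℝ 1 f.symm R'.carrier :=
    ((f.symm.differentiableOn.contDiffOn R'.isOpen).restrict_scalars ℝ).of_le le_top
  have hm1 : MapsTo (Function.invFunOn (scrFun k) upperHalfPlaneSet) (scrRect k) upperHalfPlaneSet :=
    (scrFun_bijOn hk0 hk1).surjOn.mapsTo_invFunOn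
  have h12 : ContDiffOn ℝ 1 (fun w => F (Function.invFunOn (scrFun k) upperHalfPlaneSet w))
      (scrRect k) := h2.comp h1 hm1
  have h123 : ContDiffOn ℝ 1 (fun w => (shearHomeomorph α hα.ne').symm
      (F (Function.invFunOn (scrFun k) upperHalfPlaneSet w))) (scrRect k) :=
    h3.comp h12 (mapsTo_univ _ _)
  refine h4.comp h123 fun w hw => ?_
  exact symm_mem_carrier hα (F.mapsTo (hm1 hw))

end Bijection

/-! ### The real derivative of the comparison map has the shear form -/

section Derivative

variable {R' : ConformalRectangle} {α : ℂ} (hα : 0 < α.im)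
  (f : ConformalEquiv upperHalfPlaneSet R'.carrier)
  (F : ConformalEquiv upperHalfPlaneSet (R'.map (shearHomeomorph α hα.ne')).carrier)
  {k : ℝ} (hk0 : 0 < k) (hk1 : k < 1)
include hk0 hk1

/-- `F_k ∘ F⁻¹` is holomorphic on `φ_α(Ω')`. [folklore] -/
theorem differentiableOn_scrFun_symm :
    DifferentiableOn ℂ (fun w => scrFun k (F.symm w)) (R'.map (shearHomeomorph α hα.ne')).carrier :=
  (differentiableOn_scrFun_upperHalfPlaneSet hk0.le hk1.le).comp F.symm.differentiableOn
    F.symm_mapsTo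

/-- `(F_k ∘ F⁻¹)′ ≠ 0` on `φ_α(Ω')`. [folklore] -/
theorem deriv_scrFun_symm_ne_zero {q : ℂ} (hq : q ∈ (R'.map (shearHomeomorph α hα.ne')).carrier) :
    deriv (fun w => scrFun k (F.symm w)) q ≠ 0 := by
  have hopen : IsOpen (R'.map (shearHomeomorph α hα.ne')).carrier := (R'.map _).isOpen
  have h1 : HasDerivAt F.symm (deriv F.symm q) q :=
    ((F.symm.differentiableOn q hq).differentiableAt (hopen.mem_nhds hq)).hasDerivAt
  have h2 : HasDerivAt (scrFun k) (scrDeriv k (F.symm q)) (F.symm q) :=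
    hasDerivAt_scrFun_of_mem hk0.le hk1.le (F.symm_mapsTo hq)
  have h : HasDerivAt (fun w => scrFun k (F.symm w)) (scrDeriv k (F.symm q) * deriv F.symm q) q :=
    h2.comp q h1
  rw [h.deriv]
  exact mul_ne_zero (scrDeriv_ne_zero hk0.le hk1.le (upperHalfPlaneSet_subset_scrDomain
    (F.symm_mapsTo hq))) (ConformalEquiv.deriv_ne_zero_holds F.symm hopen hq)

omit hk0 hk1 in
/-- `f′ ≠ 0` on `ℍₒ`. [folklore] -/
theorem deriv_ne_zero' {z : ℂ} (hz : z ∈ upperHalfPlaneSet) : deriv f z ≠ 0 :=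
  ConformalEquiv.deriv_ne_zero_holds f isOpen_upperHalfPlaneSet hz

/-- **The real derivative of `Θ₀` in shear form.** At `z ∈ ℍₒ`,
`DΘ₀(z) v = φ_α(v · f′(z)) · γ`, `γ = (F_k ∘ F⁻¹)′(φ_α(f z))`. [folklore] -/
theorem hasFDerivAt_comparison {z : ℂ} (hz : z ∈ upperHalfPlaneSet) :
    HasFDerivAt (fun w => scrFun k (F.symm (moduliShear α (f w))))
      (((ContinuousLinearMap.smulRight (1 : ℂ →L[ℂ] ℂ)
          (deriv (fun w => scrFun k (F.symm w)) (moduliShear α (f z)))).restrictScalars ℝ).comp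
        ((Complex.reCLM.smulRight (1 : ℂ) + Complex.imCLM.smulRight α).comp
          ((ContinuousLinearMap.smulRight (1 : ℂ →L[ℂ] ℂ) (deriv f z)).restrictScalars ℝ))) z := by
  have hopen : IsOpen (R'.map (shearHomeomorph α hα.ne')).carrier := (R'.map _).isOpen
  set S : ℂ →L[ℝ] ℂ := Complex.reCLM.smulRight (1 : ℂ) + Complex.imCLM.smulRight α with hS
  have hSapp : ∀ v, S v = moduliShear α v := by
    intro v
    simp only [hS, add_apply, ContinuousLinearMap.smulRight_apply,
      Complex.reCLM_apply, Complex.imCLM_apply, Complex.real_smul, mul_one, moduliShear]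
    ring
  -- `f`
  have hf : HasFDerivAt f ((ContinuousLinearMap.smulRight (1 : ℂ →L[ℂ] ℂ) (deriv f z)).restrictScalars ℝ) z := by
    have h := ((f.differentiableOn z hz).differentiableAt (isOpen_upperHalfPlaneSet.mem_nhds hz)).hasDerivAt
    exact (hasDerivAt_iff_hasFDerivAt.1 h).restrictScalars ℝ
  -- `φ_α ∘ f`
  have hSf : HasFDerivAt (fun w => moduliShear α (f w))
      (S.comp ((ContinuousLinearMap.smulRight (1 : ℂ →L[ℂ] ℂ) (deriv f z)).restrictScalars ℝ)) z := by
    have e : (fun w => moduliShear α (f w)) = S ∘ f := funext fun w => (hSapp (f w)).symm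
    rw [e]
    exact S.hasFDerivAt.comp z hf
  -- `F_k ∘ F⁻¹`
  have hq : moduliShear α (f z) ∈ (R'.map (shearHomeomorph α hα.ne')).carrier :=
    moduliShear_mem_carrier_map hα (f.mapsTo hz)
  have hg : HasFDerivAt (fun w => scrFun k (F.symm w))
      ((ContinuousLinearMap.smulRight (1 : ℂ →L[ℂ] ℂ)
        (deriv (fun w => scrFun k (F.symm w)) (moduliShear α (f z)))).restrictScalars ℝ)
      (moduliShear α (f z)) := by
    have h := ((differentiableOn_scrFun_symm hα F hk0 hk1 _ hq).differentiableAt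
      (hopen.mem_nhds hq)).hasDerivAt
    exact (hasDerivAt_iff_hasFDerivAt.1 h).restrictScalars ℝ
  exact hg.comp z hSf

omit hk0 hk1 in
/-- The shear-form derivative at `1`: `A 1 = γ · φ_α(f′ z)`. [folklore] -/
theorem comparisonDeriv_apply_one (γ c : ℂ) :
    (((ContinuousLinearMap.smulRight (1 : ℂ →L[ℂ] ℂ) γ).restrictScalars ℝ).comp
        ((Complex.reCLM.smulRight (1 : ℂ) + Complex.imCLM.smulRight α).comp
          ((ContinuousLinearMap.smulRight (1 : ℂ →L[ℂ] ℂ) c).restrictScalars ℝ))) 1 =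
      γ * moduliShear α c := by
  simp only [ContinuousLinearMap.coe_comp, Function.comp_apply,
    ContinuousLinearMap.coe_restrictScalars', ContinuousLinearMap.smulRight_apply,
    one_apply_eq_self, add_apply, Complex.reCLM_apply,
    Complex.imCLM_apply, Complex.real_smul, mul_one, one_mul, smul_eq_mul, moduliShear]
  ring

omit hk0 hk1 in
/-- The shear-form derivative at `i`: `A i = γ · φ_α(i f′ z)`. [folklore] -/
theorem comparisonDeriv_apply_I (γ c : ℂ) :
    (((ContinuousLinearMap.smulRight (1 : ℂ →L[ℂ] ℂ) γ).restrictScalars ℝ).comp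
        ((Complex.reCLM.smulRight (1 : ℂ) + Complex.imCLM.smulRight α).comp
          ((ContinuousLinearMap.smulRight (1 : ℂ →L[ℂ] ℂ) c).restrictScalars ℝ))) I =
      γ * moduliShear α (I * c) := by
  simp only [ContinuousLinearMap.coe_comp, Function.comp_apply,
    ContinuousLinearMap.coe_restrictScalars', ContinuousLinearMap.smulRight_apply,
    one_apply_eq_self, add_apply, Complex.reCLM_apply,
    Complex.imCLM_apply, Complex.real_smul, mul_one, smul_eq_mul, moduliShear]
  ring

end Derivative

end ShearComparison

end Literature.Probability.RandomPlanarGeometry
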